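import Summits.AnomalousDissipation.AnomalousDissipation.Theorems.SawtoothPulseCascadeK1LocalisedCascadePhaseOneOffTubeBound
import Summits.AnomalousDissipation.AnomalousDissipation.Theorems.SawtoothPulseCascadeK1LocalisedCascadeVFibreParity

/-!
# K1loc explicit start, phase 1: THE V/O JUNK FRAME — from per-H-fibre certificates to `j_V + j_O` («VOJunkFrame»)

Helper file of the prover lane on the crux `K1LocalisedCascade` (stmt-AnomalousDissipation-19491), route `SawtoothPulseCascade`
(arbiter A24-6 steps (3)–(5)).  The two junk functionals of `a₂ = b₁ ∘ Φ_V` entering `…PhaseOneJunkSplit.phaseTwo_start20_le_of_junk`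
at `K′ = 120` — `j_V = Σ'[120 ≤ |k₁| ∧ |k₀| < 800]` and `j_O = Σ'[800 ≤ |k₀| ≤ 4|k₁|]` of `‖𝓕a₂‖²` — are reduced to PER-H-FIBRE CERTIFICATES
for `b₁`: (i) the junk region lies in the V-fibre windows `|k₀| ≤ W(k₁)` (`W = 799` below `|k₁| = 200`, `4|k₁|` above) of the fibres
`120 ≤ |k₁| ≤ 3600` plus the tail `|k₁| > 3600`; (ii) on each fibre `…VFibreParity.vfibre_window_sq_parity_le` with the tube
`S_n = {|p| ≤ 400, |8|p| − |n|| < 400}`, weights `u`, class bound `Γ_n`; (iii) the tube sums are regrouped onto the H-fibres `|p| ≤ 400` of `b₁`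
(`T_p = {n : 120 ≤ |n| ≤ 3600, |8|p| − |n|| < 400}`), where the certificates `Σ_{n∈T_p} (Γ_n/u) ‖𝓕b₁(p,n)‖² ≤ V_p` are the input; (iv) the
sources off the tube and the tail are off-tube-or-H-tail lattice points: `≤ 46/10⁴ + 181/10⁶` (`phaseOne_offTube400_le`, `phaseOne_hTail_le`);
(v) the rounding term is absorbed into the main term (`u ≤ 1`, `Γ ≥ γ₀`):  **`vo_junk_le_of_fibre_certs`**: `j_V + j_O ≤
(1 + t + (1+1/t)(1+1/s)(2⁻²⁷·3600)²/γ₀)·Σ_{|p|≤400} V_p + (1+1/t)(1+s)(46/10⁴ + 181/10⁶)`. No definitions. [cite: Grafakos2014, Prop. 3.2.7 (3)] [problem: turb]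
-/

-- `Summit.<Summit>.<Problem>`: single-conjunct summit, the duplicate namespace segment is deliberate.
set_option linter.dupNamespace false

noncomputable section

namespace Summit.AnomalousDissipation.AnomalousDissipation.Theorems.SawtoothPulseCascade.K1Start

open MeasureTheory Filter Topology UnitAddTorus Complex AddCircle
open scoped Real
open Literature.Analysis Literature.Analysis.FunctionSpaces Literature.Analysis.FunctionSpaces.Torus Literature.Analysis.FluidPDE
open Literature.Analysis.FluidPDE.ShearStage
open Literature.Analysis.FluidPDE.SawtoothCascade Literature.Analysis.FluidPDE.SawtoothCascade.CascadeParams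
open Summit.AnomalousDissipation.AnomalousDissipation.Theorems.SawtoothPulseCascade.K1Window

/-! ## §1 Lattice bookkeeping -/

/-- The two junk indicators are disjoint: `[120 ≤ |k₁| ∧ |k₀| < 800] + [800 ≤ |k₀| ≤ 4|k₁|] ≤ 1`. [folklore] -/
theorem junk_indicators_le_one (k : Fin 2 → ℤ) :
    (if (120 : ℤ) ≤ |k 1| ∧ |k 0| < 800 then (1 : ℝ) else 0) + (if (800 : ℤ) ≤ |k 0| ∧ |k 0| ≤ 4 * |k 1| then (1 : ℝ) else 0) ≤ 1 := by
  by_cases h1 : (120 : ℤ) ≤ |k 1| ∧ |k 0| < 800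
  · have h2 : ¬ ((800 : ℤ) ≤ |k 0| ∧ |k 0| ≤ 4 * |k 1|) := fun h => by omega
    rw [if_pos h1, if_neg h2]; norm_num
  · rw [if_neg h1, zero_add]; split_ifs <;> norm_num

/-- The junk region is inside the fibre windows or the tail: for every `k`,
`[120 ≤ |k₁| ∧ |k₀| < 800] + [800 ≤ |k₀| ≤ 4|k₁|] ≤ Σ_{n∈B} [k₁ = n ∧ |k₀| ≤ W(n)] + [3600 < |k₁|]`. [folklore] -/
theorem junk_indicator_le (k : Fin 2 → ℤ) :
    (if (120 : ℤ) ≤ |k 1| ∧ |k 0| < 800 then (1 : ℝ) else 0) + (if (800 : ℤ) ≤ |k 0| ∧ |k 0| ≤ 4 * |k 1| then (1 : ℝ) else 0) ≤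
      (∑ n ∈ (Finset.Icc (-3600 : ℤ) 3600).filter (fun n => 120 ≤ |n|),
          (if k 1 = n ∧ k 0 ∈ Finset.Icc (-(if |n| < 200 then (799 : ℤ) else 4 * |n|)) (if |n| < 200 then (799 : ℤ) else 4 * |n|)
            then (1 : ℝ) else 0)) +
        (if (3600 : ℤ) < |k 1| then (1 : ℝ) else 0) := by
  have hsum0 : 0 ≤ ∑ n ∈ (Finset.Icc (-3600 : ℤ) 3600).filter (fun n => 120 ≤ |n|),
      (if k 1 = n ∧ k 0 ∈ Finset.Icc (-(if |n| < 200 then (799 : ℤ) else 4 * |n|)) (if |n| < 200 then (799 : ℤ) else 4 * |n|)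
        then (1 : ℝ) else 0) := Finset.sum_nonneg fun _ _ => by split_ifs <;> norm_num
  by_cases hT : (3600 : ℤ) < |k 1|
  · rw [if_pos hT]; linarith [junk_indicators_le_one k]
  · rw [if_neg hT, add_zero]
    by_cases hJ : ((120 : ℤ) ≤ |k 1| ∧ |k 0| < 800) ∨ ((800 : ℤ) ≤ |k 0| ∧ |k 0| ≤ 4 * |k 1|)
    · -- the fibre `n = k 1` is in `B` and `k 0` is in its window
      have hB : k 1 ∈ (Finset.Icc (-3600 : ℤ) 3600).filter (fun n => 120 ≤ |n|) := by
        rw [Finset.mem_filter, Finset.mem_Icc]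
        have := abs_choice (k 1); have := abs_nonneg (k 1); have := abs_nonneg (k 0)
        refine ⟨⟨by omega, by omega⟩, by omega⟩
      have hW : k 0 ∈ Finset.Icc (-(if |k 1| < 200 then (799 : ℤ) else 4 * |k 1|)) (if |k 1| < 200 then (799 : ℤ) else 4 * |k 1|) := by
        rw [Finset.mem_Icc]
        have := abs_choice (k 0); have := abs_nonneg (k 0); have := abs_nonneg (k 1)
        split_ifs with h200 <;> constructor <;> omega
      have hone : (1 : ℝ) ≤ ∑ n ∈ (Finset.Icc (-3600 : ℤ) 3600).filter (fun n => 120 ≤ |n|),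
          (if k 1 = n ∧ k 0 ∈ Finset.Icc (-(if |n| < 200 then (799 : ℤ) else 4 * |n|)) (if |n| < 200 then (799 : ℤ) else 4 * |n|)
            then (1 : ℝ) else 0) := by
        rw [← Finset.add_sum_erase _ _ hB, if_pos ⟨rfl, hW⟩]
        have : 0 ≤ ∑ n ∈ ((Finset.Icc (-3600 : ℤ) 3600).filter (fun n => 120 ≤ |n|)).erase (k 1),
            (if k 1 = n ∧ k 0 ∈ Finset.Icc (-(if |n| < 200 then (799 : ℤ) else 4 * |n|)) (if |n| < 200 then (799 : ℤ) else 4 * |n|)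
              then (1 : ℝ) else 0) := Finset.sum_nonneg fun _ _ => by split_ifs <;> norm_num
        linarith
      linarith [junk_indicators_le_one k]
    · rw [not_or] at hJ
      rw [if_neg hJ.1, if_neg hJ.2, add_zero]
      exact hsum0

/-- Off the tube or in the tail ⇒ off-tube or in the H-tail: for `n ∈ B` and `q ∉ S_n`, `400 < |q| ∨ 400 ≤ ||n| − |8q||`. [folklore] -/
theorem offTube_of_not_mem_tube {n q : ℤ}
    (hq : q ∉ (Finset.Icc (-400 : ℤ) 400).filter (fun p => |(8 * |p| - |n|)| < 400)) :
    (400 : ℤ) < |q| ∨ (400 : ℤ) ≤ |(|n| - |8 * q|)| := by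
  rw [Finset.mem_filter, Finset.mem_Icc] at hq
  have h1 := abs_choice n; have h2 := abs_choice q; have h4 := abs_choice (8 * |q| - |n|); have h5 := abs_choice (|n| - |8 * q|)
  have h6 : |8 * q| = 8 * |q| := by rw [abs_mul]; norm_num
  have := abs_nonneg q; have := abs_nonneg n; have := abs_nonneg (|n| - |8 * q|); have := abs_nonneg (8 * |q| - |n|)
  omega

/-- In the tail `|n| > 3600` every point is off-tube or in the H-tail. [folklore] -/
theorem offTube_of_tail {n q : ℤ} (hn : (3600 : ℤ) < |n|) : (400 : ℤ) < |q| ∨ (400 : ℤ) ≤ |(|n| - |8 * q|)| := by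
  have h2 := abs_choice q; have h5 := abs_choice (|n| - |8 * q|); have h6 : |8 * q| = 8 * |q| := by rw [abs_mul]; norm_num
  have := abs_nonneg q; have := abs_nonneg n; have := abs_nonneg (|n| - |8 * q|)
  omega

/-- Windows stay below the lobes: `n ∈ B`, `|m| ≤ W(n)`, `p ∈ S_n` ⇒ `m − p ≠ ∓8n`. [folklore] -/
theorem window_source_ne_lobe {n m p : ℤ} (hn : 120 ≤ |n|)
    (hm : m ∈ Finset.Icc (-(if |n| < 200 then (799 : ℤ) else 4 * |n|)) (if |n| < 200 then (799 : ℤ) else 4 * |n|))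
    (hp : p ∈ (Finset.Icc (-400 : ℤ) 400).filter (fun p => |(8 * |p| - |n|)| < 400)) :
    8 * n + (m - p) ≠ 0 ∧ 8 * n - (m - p) ≠ 0 := by
  rw [Finset.mem_filter, Finset.mem_Icc] at hp
  rw [Finset.mem_Icc] at hm
  have h1 := abs_choice n; have h2 := abs_choice p; have h4 := abs_choice (8 * |p| - |n|)
  have := abs_nonneg n; have := abs_nonneg p; have := abs_nonneg (8 * |p| - |n|)
  obtain ⟨hm1, hm2⟩ := hm
  split_ifs at hm1 hm2 <;> constructor <;> omega

/-- Restricting a nonnegative summable family to a decidable set keeps it summable. [folklore] -/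
theorem summable_ite_of_summable {ι : Type*} {c : ι → ℝ} (hc : Summable c) (h0 : ∀ k, 0 ≤ c k) (p : ι → Prop)
    [DecidablePred p] : Summable fun k => if p k then c k else 0 :=
  Summable.of_nonneg_of_le (fun k => by by_cases h : p k <;> simp [h, h0 k]) (fun k => by by_cases h : p k <;> simp [h, h0 k]) hc

/-- **Regrouping the tube onto the H-fibres**: `Σ_{n∈B} Σ_{p∈S_n} f(n,p) = Σ_{|p|≤400} Σ_{n∈T_p} f(n,p)`. [folklore] -/
theorem sum_tube_swap (f : ℤ → ℤ → ℝ) :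
    ∑ n ∈ (Finset.Icc (-3600 : ℤ) 3600).filter (fun n => 120 ≤ |n|),
        ∑ p ∈ (Finset.Icc (-400 : ℤ) 400).filter (fun p => |(8 * |p| - |n|)| < 400), f n p =
      ∑ p ∈ Finset.Icc (-400 : ℤ) 400,
        ∑ n ∈ ((Finset.Icc (-3600 : ℤ) 3600).filter (fun n => 120 ≤ |n|)).filter (fun n => |(8 * |p| - |n|)| < 400), f n p := by
  rw [Finset.sum_congr rfl fun n _ => Finset.sum_filter _ _, Finset.sum_comm]
  exact Finset.sum_congr rfl fun p _ => (Finset.sum_filter _ _).symm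

section Cascade

variable (P : CascadeParams) (hγ : P.γ = 8) (hN₀ : P.N₀ = 1) (hρN : P.ρN = 2) (hd : P.d = 2) (hδ₀ : 0 < P.δ₀)
  (hδ₀' : P.δ₀ ≤ (2 : ℝ)⁻¹ ^ 30) (a b : ℕ → UnitAddTorus (Fin 2) → ℝ) (h0 : a 0 = datum)
  (hb : ∀ j, b j = a j ∘ shearMap 0 1 (amp ⟨P.U j, P.U_periodic j, P.contDiff_U (P.δ_pos hδ₀ (by rw [hd]; norm_num) j)⟩ P.γ))
  (hab : ∀ j, a (j + 1) = b j ∘ shearMap 1 0 (amp ⟨P.U j, P.U_periodic j, P.contDiff_U (P.δ_pos hδ₀ (by rw [hd]; norm_num) j)⟩ P.γ))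

include hγ hN₀ hρN hd hδ₀' h0 hb hab

/-! ## §2 Off the tube and in the tail: off-tube or H-tail energy of `b₁` -/

/-- **Sources off the tube and the tail**: `Σ_{n∈B} Σ'_{q∉S_n} ‖𝓕b₁(q,n)‖² + Σ'[3600 < |k₁|] ‖𝓕a₂‖² ≤ 46/10⁴ + 181/10⁶`.
[cite: Grafakos2014, Prop. 3.1.2 (5), Prop. 3.2.7 (3)] -/
theorem offTube_tail_le :
    ∑ n ∈ (Finset.Icc (-3600 : ℤ) 3600).filter (fun n => 120 ≤ |n|),
        ∑' q : ℤ, (if q ∈ (Finset.Icc (-400 : ℤ) 400).filter (fun p => |(8 * |p| - |n|)| < 400) then 0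
          else ‖mFourierCoeff (fun x => (b 1 x : ℂ)) ![q, n]‖ ^ 2) +
      ∑' k : Fin 2 → ℤ, (if (3600 : ℤ) < |k 1| then (1 : ℝ) else 0) * ‖mFourierCoeff (fun x => (a 2 x : ℂ)) k‖ ^ 2 ≤
      46 / 10 ^ 4 + 181 / 10 ^ 6 := by
  classical
  have hd' : 0 < P.d := by rw [hd]; norm_num
  set ψ₀ : ShearProfile := amp ⟨P.U 0, P.U_periodic 0, P.contDiff_U (P.δ_pos hδ₀ hd' 0)⟩ P.γ with hψ₀
  set ψ₁ : ShearProfile := amp ⟨P.U 1, P.U_periodic 1, P.contDiff_U (P.δ_pos hδ₀ hd' 1)⟩ P.γ with hψ₁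
  have hb0 : b 0 = datum ∘ shearMap 0 1 ψ₀ := by rw [hb 0, h0]
  have ha1 : a 1 = b 0 ∘ shearMap 1 0 ψ₀ := hab 0; have hb1 : b 1 = a 1 ∘ shearMap 0 1 ψ₁ := hb 1; have ha2 := hab 1
  have ha1c : Continuous (a 1) := ha1 ▸ hb0 ▸ (isSmooth_datum_comp_shearMap ψ₀).continuous.comp (continuous_shearMap 1 0 ψ₀)
  have hb1c : Continuous (b 1) := hb1 ▸ ha1c.comp (continuous_shearMap 0 1 ψ₁)
  set c : (Fin 2 → ℤ) → ℝ := fun k => ‖mFourierCoeff (fun x => (b 1 x : ℂ)) k‖ ^ 2 with hc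
  have hcs : Summable c := (hasSum_sq_mFourierCoeff_of_continuous (Complex.continuous_ofReal.comp hb1c)).summable
  have hc0 : ∀ k, 0 ≤ c k := fun k => sq_nonneg _
  -- the two indicators and their union
  set χ₁ : (Fin 2 → ℤ) → ℝ := fun k =>
    if |k 1| ≤ 3600 ∧ ((400 : ℤ) < |k 0| ∨ (400 : ℤ) ≤ |(|k 1| - |8 * k 0|)|) then 1 else 0 with hχ₁
  set χ₂ : (Fin 2 → ℤ) → ℝ := fun k => if (3600 : ℤ) < |k 1| then 1 else 0 with hχ₂
  set χH : (Fin 2 → ℤ) → ℝ := fun k => if (400 : ℤ) < |k 0| then 1 else 0 with hχH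
  set χO : (Fin 2 → ℤ) → ℝ := fun k => if (400 : ℤ) ≤ |(|k 1| - |8 * k 0|)| then 1 else 0 with hχO
  -- (a) the off-tube sources: `Σ_n off_n ≤ Σ' χ₁ c`
  have h1 := sum_offTube_le_tsum c hcs hc0 ((Finset.Icc (-3600 : ℤ) 3600).filter (fun n => 120 ≤ |n|))
    (fun n => (Finset.Icc (-400 : ℤ) 400).filter (fun p => |(8 * |p| - |n|)| < 400)) χ₁
    (fun k => by simp only [hχ₁]; split_ifs <;> norm_num) (fun k => by simp only [hχ₁]; split_ifs <;> norm_num)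
    (fun n hn q hq => by
      simp only [hχ₁, Matrix.cons_val_one, Matrix.cons_val_zero]
      rw [Finset.mem_filter, Finset.mem_Icc] at hn
      rw [if_pos ⟨abs_le.2 ⟨hn.1.1, hn.1.2⟩, offTube_of_not_mem_tube hq⟩])
  -- (b) the tail, transported to `b₁`
  have h2 : ∑' k : Fin 2 → ℤ, (if (3600 : ℤ) < |k 1| then (1 : ℝ) else 0) * ‖mFourierCoeff (fun x => (a 2 x : ℂ)) k‖ ^ 2 =
      ∑' k : Fin 2 → ℤ, χ₂ k * c k := by
    simp only [hχ₂, hc]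
    exact tsum_verticalWeight_vstep hb1c ψ₁ ha2 (w := fun m : ℤ => if (3600 : ℤ) < |m| then (1 : ℝ) else 0) (C := 1)
      (fun m => by split_ifs <;> simp)
  -- (c) `χ₁ + χ₂ ≤ χH + χO`
  have h3 : ∑' k, χ₁ k * c k + ∑' k, χ₂ k * c k ≤ ∑' k, χH k * c k + ∑' k, χO k * c k := by
    have hs : ∀ χ : (Fin 2 → ℤ) → ℝ, (∀ k, 0 ≤ χ k) → (∀ k, χ k ≤ 1) → Summable fun k => χ k * c k := fun χ h0' h1' =>
      Summable.of_nonneg_of_le (fun k => mul_nonneg (h0' k) (hc0 k)) (fun k => mul_le_of_le_one_left (hc0 k) (h1' k)) hcs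
    have s1 := hs χ₁ (fun k => by simp only [hχ₁]; split_ifs <;> norm_num) (fun k => by simp only [hχ₁]; split_ifs <;> norm_num)
    have s2 := hs χ₂ (fun k => by simp only [hχ₂]; split_ifs <;> norm_num) (fun k => by simp only [hχ₂]; split_ifs <;> norm_num)
    have sH := hs χH (fun k => by simp only [hχH]; split_ifs <;> norm_num) (fun k => by simp only [hχH]; split_ifs <;> norm_num)
    have sO := hs χO (fun k => by simp only [hχO]; split_ifs <;> norm_num) (fun k => by simp only [hχO]; split_ifs <;> norm_num)
    rw [← s1.tsum_add s2, ← sH.tsum_add sO]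
    refine Summable.tsum_le_tsum (fun k => ?_) (s1.add s2) (sH.add sO)
    rw [← add_mul, ← add_mul]
    refine mul_le_mul_of_nonneg_right ?_ (hc0 k)
    simp only [hχ₁, hχ₂, hχH, hχO]
    by_cases hT : (3600 : ℤ) < |k 1|
    · have hoff := offTube_of_tail (q := k 0) hT
      have hnT : ¬ (|k 1| ≤ 3600 ∧ ((400 : ℤ) < |k 0| ∨ (400 : ℤ) ≤ |(|k 1| - |8 * k 0|)|)) := fun h => by omega
      rw [if_neg hnT, if_pos hT, zero_add]
      rcases hoff with h | h
      · rw [if_pos h]; split_ifs <;> norm_num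
      · rw [if_pos h]; split_ifs <;> norm_num
    · rw [if_neg hT, add_zero]
      by_cases hA : |k 1| ≤ 3600 ∧ ((400 : ℤ) < |k 0| ∨ (400 : ℤ) ≤ |(|k 1| - |8 * k 0|)|)
      · rw [if_pos hA]
        rcases hA.2 with h | h
        · rw [if_pos h]; split_ifs <;> norm_num
        · rw [if_pos h]; split_ifs <;> norm_num
      · rw [if_neg hA]; split_ifs <;> norm_num
  -- (d) the two certified tails
  have hH : ∑' k, χH k * c k ≤ 181 / 10 ^ 6 := by
    have e := tsum_horizontalWeight_hstep ha1c ψ₁ hb1 (w := fun m : ℤ => if (400 : ℤ) < |m| then (1 : ℝ) else 0)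
      (C := 1) (fun m => by split_ifs <;> simp)
    simp only [hχH, hc]
    rw [e]
    have e2 : (fun k : Fin 2 → ℤ => (if (400 : ℤ) < |k 0| then (1 : ℝ) else 0) * ‖mFourierCoeff (fun x => (a 1 x : ℂ)) k‖ ^ 2) =
        fun k => (if (401 : ℤ) ≤ |k 0| then (1 : ℝ) else 0) * ‖mFourierCoeff (fun x => (a 1 x : ℂ)) k‖ ^ 2 := by
      funext k
      have : ((400 : ℤ) < |k 0|) ↔ ((401 : ℤ) ≤ |k 0|) := by omega
      simp only [this]
    rw [e2]
    exact phaseOne_hTail_le P hγ hN₀ hδ₀ hδ₀' hd' a b h0 (hb 0) (hab 0)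
  have hOt : ∑' k, χO k * c k ≤ 46 / 10 ^ 4 := by
    simp only [hχO, hc]
    exact phaseOne_offTube400_le P hγ hN₀ hρN hd hδ₀ hδ₀' a b h0 hb hab
  rw [h2]
  linarith

/-! ## §3 The frame -/

/-- **THE V/O JUNK FROM PER-H-FIBRE CERTIFICATES** (`γ = 8`, `N₀ = 1`, `ρ_N = 2`, `d = 2`, `0 < δ₀ ≤ 2⁻³⁰`; `K′ = 120`, `K_2 = 800`, cone `(1,4)`):
with `B = {120 ≤ |n| ≤ 3600}`, `W(n) = 799 / 4|n|`, `S_n = {|p| ≤ 400, |8|p|−|n|| < 400}`, `T_p = {n ∈ B : |8|p|−|n|| < 400}`, weights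
`0 < u ≤ 1`, a class bound `Γ ≥ γ₀ > 0` (`Σ_{p∈S_n, p≡r (4)} u(n,p)·Σ_{|m|≤W(n)} ‖ĝ₀ⁿ(m−p)‖² ≤ Γ_n`, `ĝ₀ⁿ` the exact two-tooth chirp of lobe `8n`)
and per-H-fibre certificates `Σ_{n∈T_p} (Γ_n/u(n,p))‖𝓕b₁(p,n)‖² ≤ V_p` (`|p| ≤ 400`), for all `t, s > 0`:
`j_V + j_O ≤ (1 + t + (1+1/t)(1+1/s)(2⁻²⁷·3600)²/γ₀)·Σ_{|p|≤400} V_p + (1+1/t)(1+s)(46/10⁴ + 181/10⁶)`.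
[cite: Grafakos2014, Prop. 3.1.2 (5), Prop. 3.2.7 (3)] -/
theorem vo_junk_le_of_fibre_certs (u : ℤ → ℤ → ℝ) (hu0 : ∀ n p, 0 < u n p) (hu1 : ∀ n p, u n p ≤ 1)
    (Γ : ℤ → ℝ) {γ₀ : ℝ} (hγ₀ : 0 < γ₀)
    (hΓ₀ : ∀ n ∈ (Finset.Icc (-3600 : ℤ) 3600).filter (fun n => 120 ≤ |n|), γ₀ ≤ Γ n)
    (hΓ : ∀ n ∈ (Finset.Icc (-3600 : ℤ) 3600).filter (fun n => 120 ≤ |n|), ∀ r ∈ Finset.Icc (0 : ℤ) 3,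
      ∑ p ∈ ((Finset.Icc (-400 : ℤ) 400).filter (fun p => |(8 * |p| - |n|)| < 400)).filter (fun p => p % 4 = r),
        u n p * ∑ m ∈ Finset.Icc (-(if |n| < 200 then (799 : ℤ) else 4 * |n|)) (if |n| < 200 then (799 : ℤ) else 4 * |n|),
          ‖fourierCoeff ((periodic_exactChirpFun 2 (8 * n)).lift) (m - p)‖ ^ 2 ≤ Γ n)
    (V : ℤ → ℝ)
    (hV : ∀ p ∈ Finset.Icc (-400 : ℤ) 400,
      ∑ n ∈ ((Finset.Icc (-3600 : ℤ) 3600).filter (fun n => 120 ≤ |n|)).filter (fun n => |(8 * |p| - |n|)| < 400),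
        Γ n / u n p * ‖mFourierCoeff (fun x => (b 1 x : ℂ)) ![p, n]‖ ^ 2 ≤ V p)
    {t s : ℝ} (ht : 0 < t) (hs : 0 < s) :
    ∑' k : Fin 2 → ℤ, (if (120 : ℤ) ≤ |k 1| ∧ |k 0| < 800 then (1 : ℝ) else 0) * ‖mFourierCoeff (fun x => (a 2 x : ℂ)) k‖ ^ 2 +
        ∑' k : Fin 2 → ℤ, (if (800 : ℤ) ≤ |k 0| ∧ |k 0| ≤ 4 * |k 1| then (1 : ℝ) else 0) *
          ‖mFourierCoeff (fun x => (a 2 x : ℂ)) k‖ ^ 2 ≤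
      (1 + t + (1 + 1 / t) * (1 + 1 / s) * ((2 : ℝ)⁻¹ ^ 27 * 3600) ^ 2 / γ₀) * ∑ p ∈ Finset.Icc (-400 : ℤ) 400, V p +
        (1 + 1 / t) * (1 + s) * (46 / 10 ^ 4 + 181 / 10 ^ 6) := by
  classical
  have hπ : 0 < π := Real.pi_pos
  have hd' : 0 < P.d := by rw [hd]; norm_num
  set ψ₀ : ShearProfile := amp ⟨P.U 0, P.U_periodic 0, P.contDiff_U (P.δ_pos hδ₀ hd' 0)⟩ P.γ with hψ₀
  set ψ₁ : ShearProfile := amp ⟨P.U 1, P.U_periodic 1, P.contDiff_U (P.δ_pos hδ₀ hd' 1)⟩ P.γ with hψ₁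
  have hb0 : b 0 = datum ∘ shearMap 0 1 ψ₀ := by rw [hb 0, h0]
  have ha1 : a 1 = b 0 ∘ shearMap 1 0 ψ₀ := hab 0; have hb1 : b 1 = a 1 ∘ shearMap 0 1 ψ₁ := hb 1; have ha2 := hab 1
  have ha1s : IsSmooth (a 1) := ha1 ▸ hb0 ▸ (isSmooth_datum_comp_shearMap ψ₀).comp_shearMap 1 0 ψ₀
  have hb1s : IsSmooth (b 1) := hb1 ▸ ha1s.comp_shearMap 0 1 ψ₁
  have hθc : Continuous (fun x => (b 1 x : ℂ)) := Complex.continuous_ofReal.comp hb1s.continuous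
  have hθsum : Summable fun k => ‖mFourierCoeff (fun x => (b 1 x : ℂ)) k‖ := summable_norm_mFourierCoeff_ofReal_of_isSmooth hb1s
  have ha2θ : (fun x => (a 2 x : ℂ)) = (fun x => (b 1 x : ℂ)) ∘ shearMap 1 0 ψ₁ := by rw [ha2]; rfl
  have ha2c : Continuous (a 2) := by rw [ha2]; exact hb1s.continuous.comp (continuous_shearMap 1 0 ψ₁)
  -- opaque names for the two coefficient families
  obtain ⟨c, hc⟩ : ∃ c : (Fin 2 → ℤ) → ℝ, ∀ k, c k = ‖mFourierCoeff (fun x => (b 1 x : ℂ)) k‖ ^ 2 := ⟨_, fun _ => rfl⟩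
  obtain ⟨c₂, hc₂⟩ : ∃ c₂ : (Fin 2 → ℤ) → ℝ, ∀ k, c₂ k = ‖mFourierCoeff (fun x => (a 2 x : ℂ)) k‖ ^ 2 := ⟨_, fun _ => rfl⟩
  have hc₂f : c₂ = fun k => ‖mFourierCoeff (fun x => (a 2 x : ℂ)) k‖ ^ 2 := funext hc₂
  have hcs : Summable c := (funext hc : c = _) ▸ (hasSum_sq_mFourierCoeff_of_continuous hθc).summable
  have hc0 : ∀ k, 0 ≤ c k := fun k => by rw [hc]; exact sq_nonneg _
  have hc₂s : Summable c₂ := hc₂f ▸ (hasSum_sq_mFourierCoeff_of_continuous (Complex.continuous_ofReal.comp ha2c)).summable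
  have hc₂0 : ∀ k, 0 ≤ c₂ k := fun k => by rw [hc₂]; exact sq_nonneg _
  simp only [← hc] at hV
  -- §A the junk region inside the fibre windows plus the tail
  set χV : (Fin 2 → ℤ) → ℝ := fun k => if (120 : ℤ) ≤ |k 1| ∧ |k 0| < 800 then 1 else 0 with hχV
  set χOc : (Fin 2 → ℤ) → ℝ := fun k => if (800 : ℤ) ≤ |k 0| ∧ |k 0| ≤ 4 * |k 1| then 1 else 0 with hχOc
  set χT : (Fin 2 → ℤ) → ℝ := fun k => if (3600 : ℤ) < |k 1| then 1 else 0 with hχT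
  set χBk : (Fin 2 → ℤ) → ℝ := fun k => ∑ n ∈ (Finset.Icc (-3600 : ℤ) 3600).filter (fun n => 120 ≤ |n|),
    (if k 1 = n ∧ k 0 ∈ Finset.Icc (-(if |n| < 200 then (799 : ℤ) else 4 * |n|)) (if |n| < 200 then (799 : ℤ) else 4 * |n|)
      then (1 : ℝ) else 0) with hχBk
  have hsumm : ∀ χ : (Fin 2 → ℤ) → ℝ, (∀ k, 0 ≤ χ k) → (∀ k, χ k ≤ 1) → Summable fun k => χ k * c₂ k := fun χ h0' h1' =>
    Summable.of_nonneg_of_le (fun k => mul_nonneg (h0' k) (hc₂0 k)) (fun k => mul_le_of_le_one_left (hc₂0 k) (h1' k)) hc₂s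
  have hV01 : ∀ k, 0 ≤ χV k ∧ χV k ≤ 1 := fun k => by simp only [hχV]; split_ifs <;> norm_num
  have hO01 : ∀ k, 0 ≤ χOc k ∧ χOc k ≤ 1 := fun k => by simp only [hχOc]; split_ifs <;> norm_num
  have hT01 : ∀ k, 0 ≤ χT k ∧ χT k ≤ 1 := fun k => by simp only [hχT]; split_ifs <;> norm_num
  have hslab : ∀ n : ℤ, Summable fun k : Fin 2 → ℤ =>
      if k 1 = n ∧ k 0 ∈ Finset.Icc (-(if |n| < 200 then (799 : ℤ) else 4 * |n|)) (if |n| < 200 then (799 : ℤ) else 4 * |n|)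
        then c₂ k else 0 := fun n => summable_ite_of_summable hc₂s hc₂0 _
  have heBk : ∀ k, χBk k * c₂ k = ∑ n ∈ (Finset.Icc (-3600 : ℤ) 3600).filter (fun n => 120 ≤ |n|),
      (if k 1 = n ∧ k 0 ∈ Finset.Icc (-(if |n| < 200 then (799 : ℤ) else 4 * |n|)) (if |n| < 200 then (799 : ℤ) else 4 * |n|)
        then c₂ k else 0) := by
    intro k; simp only [hχBk, Finset.sum_mul]
    exact Finset.sum_congr rfl fun n _ => by split_ifs <;> simp
  have hBsum : Summable fun k => χBk k * c₂ k := by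
    simp_rw [heBk]; exact summable_sum fun n _ => hslab n
  have sV := hsumm χV (fun k => (hV01 k).1) (fun k => (hV01 k).2)
  have sO := hsumm χOc (fun k => (hO01 k).1) (fun k => (hO01 k).2)
  have sT := hsumm χT (fun k => (hT01 k).1) (fun k => (hT01 k).2)
  have hA : ∑' k, χV k * c₂ k + ∑' k, χOc k * c₂ k ≤ ∑' k, χBk k * c₂ k + ∑' k, χT k * c₂ k := by
    rw [← sV.tsum_add sO, ← hBsum.tsum_add sT]
    refine Summable.tsum_le_tsum (fun k => ?_) (sV.add sO) (hBsum.add sT)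
    rw [← add_mul, ← add_mul]
    exact mul_le_mul_of_nonneg_right (junk_indicator_le k) (hc₂0 k)
  -- §B the window part as finite fibre sums
  have hBeq : ∑' k, χBk k * c₂ k = ∑ n ∈ (Finset.Icc (-3600 : ℤ) 3600).filter (fun n => 120 ≤ |n|),
      ∑ m ∈ Finset.Icc (-(if |n| < 200 then (799 : ℤ) else 4 * |n|)) (if |n| < 200 then (799 : ℤ) else 4 * |n|), c₂ ![m, n] := by
    simp_rw [heBk]
    rw [Summable.tsum_finsetSum fun n _ => hslab n]
    exact Finset.sum_congr rfl fun n _ => tsum_vslab_window_eq_sum c₂ n _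
  -- §C per fibre: the parity bound, rounding absorbed
  have hfib : ∀ n ∈ (Finset.Icc (-3600 : ℤ) 3600).filter (fun n => 120 ≤ |n|),
      ∑ m ∈ Finset.Icc (-(if |n| < 200 then (799 : ℤ) else 4 * |n|)) (if |n| < 200 then (799 : ℤ) else 4 * |n|), c₂ ![m, n] ≤
      (1 + t + (1 + 1 / t) * (1 + 1 / s) * ((2 : ℝ)⁻¹ ^ 27 * 3600) ^ 2 / γ₀) *
          (Γ n * ∑ p ∈ (Finset.Icc (-400 : ℤ) 400).filter (fun p => |(8 * |p| - |n|)| < 400), c ![p, n] / u n p) +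
        (1 + 1 / t) * (1 + s) *
          ∑' q : ℤ, (if q ∈ (Finset.Icc (-400 : ℤ) 400).filter (fun p => |(8 * |p| - |n|)| < 400) then 0 else c ![q, n]) := by
    intro n hn
    have hn120 : 120 ≤ |n| := (Finset.mem_filter.1 hn).2
    have hn3600 : |n| ≤ 3600 := by
      have := (Finset.mem_filter.1 hn).1; rw [Finset.mem_Icc] at this; exact abs_le.2 ⟨this.1, this.2⟩
    obtain ⟨hg₀c, hg₀⟩ := continuous_exactChirp_lift 2 (8 * n)
    have hnear : ∀ t : ℝ, |n * ψ₁ t - ((8 * n : ℤ) : ℝ) * (tri (2 * π * (2 : ℕ) * t) / (2 * π * (2 : ℕ)))| ≤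
        |(n : ℝ)| * ((2 * Real.exp (1 / 2) - 1) * P.δ₀ / π) := fun t => by
      rw [hψ₁]; exact phaseOne_profile_near P hγ hN₀ hρN hd hδ₀ n t
    have hround : 2 * π * (|(n : ℝ)| * ((2 * Real.exp (1 / 2) - 1) * P.δ₀ / π)) ≤ (2 : ℝ)⁻¹ ^ 27 * |(n : ℝ)| :=
      phaseOne_rounding_le hδ₀.le hδ₀' n
    have hX := vfibre_window_sq_parity_le hθc hθsum ψ₁ n hg₀ hg₀c hnear
      ((Finset.Icc (-400 : ℤ) 400).filter (fun p => |(8 * |p| - |n|)| < 400))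
      (Finset.Icc (-(if |n| < 200 then (799 : ℤ) else 4 * |n|)) (if |n| < 200 then (799 : ℤ) else 4 * |n|))
      (fun m hm p hp => window_source_ne_lobe hn120 hm hp) (u n) (fun p _ => hu0 n p) (hΓ n hn) ht hs
    rw [← ha2θ] at hX
    simp only [← hc, ← hc₂] at hX
    have hESF : ∑ p ∈ (Finset.Icc (-400 : ℤ) 400).filter (fun p => |(8 * |p| - |n|)| < 400), c ![p, n] ≤
        ∑ p ∈ (Finset.Icc (-400 : ℤ) 400).filter (fun p => |(8 * |p| - |n|)| < 400), c ![p, n] / u n p :=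
      Finset.sum_le_sum fun p _ => by
        rw [le_div_iff₀ (hu0 n p)]
        exact mul_le_of_le_one_right (hc0 _) (hu1 n p)
    have hF0 : 0 ≤ ∑ p ∈ (Finset.Icc (-400 : ℤ) 400).filter (fun p => |(8 * |p| - |n|)| < 400), c ![p, n] / u n p :=
      Finset.sum_nonneg fun p _ => div_nonneg (hc0 _) (hu0 n p).le
    have hES0 : 0 ≤ ∑ p ∈ (Finset.Icc (-400 : ℤ) 400).filter (fun p => |(8 * |p| - |n|)| < 400), c ![p, n] :=
      Finset.sum_nonneg fun p _ => hc0 _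
    have he0 : 0 ≤ 2 * Real.exp (1 / 2) - 1 := by linarith [Real.add_one_le_exp (1 / 2 : ℝ)]
    have hη0 : 0 ≤ 2 * π * (|(n : ℝ)| * ((2 * Real.exp (1 / 2) - 1) * P.δ₀ / π)) :=
      mul_nonneg (by positivity) (mul_nonneg (abs_nonneg _) (div_nonneg (mul_nonneg he0 hδ₀.le) hπ.le))
    have hn' : |(n : ℝ)| ≤ 3600 := by exact_mod_cast hn3600
    have hηκ : (2 * π * (|(n : ℝ)| * ((2 * Real.exp (1 / 2) - 1) * P.δ₀ / π))) ^ 2 ≤ ((2 : ℝ)⁻¹ ^ 27 * 3600) ^ 2 :=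
      pow_le_pow_left₀ hη0 (hround.trans (mul_le_mul_of_nonneg_left hn' (by norm_num))) 2
    have hΓn : γ₀ ≤ Γ n := hΓ₀ n hn
    -- `(2πη)²·ES ≤ κ·F ≤ (κ/γ₀)·(Γ n·F)`
    have h1 : (2 * π * (|(n : ℝ)| * ((2 * Real.exp (1 / 2) - 1) * P.δ₀ / π))) ^ 2 *
        ∑ p ∈ (Finset.Icc (-400 : ℤ) 400).filter (fun p => |(8 * |p| - |n|)| < 400), c ![p, n] ≤
        ((2 : ℝ)⁻¹ ^ 27 * 3600) ^ 2 / γ₀ *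
          (Γ n * ∑ p ∈ (Finset.Icc (-400 : ℤ) 400).filter (fun p => |(8 * |p| - |n|)| < 400), c ![p, n] / u n p) := by
      have h1a := mul_le_mul hηκ hESF hES0 (by positivity : (0:ℝ) ≤ ((2 : ℝ)⁻¹ ^ 27 * 3600) ^ 2)
      have h1b : ((2 : ℝ)⁻¹ ^ 27 * 3600) ^ 2 *
          (∑ p ∈ (Finset.Icc (-400 : ℤ) 400).filter (fun p => |(8 * |p| - |n|)| < 400), c ![p, n] / u n p) * γ₀ ≤
          ((2 : ℝ)⁻¹ ^ 27 * 3600) ^ 2 *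
          (∑ p ∈ (Finset.Icc (-400 : ℤ) 400).filter (fun p => |(8 * |p| - |n|)| < 400), c ![p, n] / u n p) * Γ n :=
        mul_le_mul_of_nonneg_left hΓn (mul_nonneg (by positivity) hF0)
      rw [div_mul_eq_mul_div, le_div_iff₀ hγ₀]
      nlinarith [h1a, h1b, hγ₀]
    have hts0 : 0 ≤ (1 + 1 / t) * (1 + 1 / s) := by positivity
    have h2 := mul_le_mul_of_nonneg_left h1 hts0
    -- linear assembly on generalized atoms
    generalize hA : Γ n * ∑ p ∈ (Finset.Icc (-400 : ℤ) 400).filter (fun p => |(8 * |p| - |n|)| < 400), c ![p, n] / u n p = A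
      at hX h2 ⊢
    generalize hO : ∑' q : ℤ, (if q ∈ (Finset.Icc (-400 : ℤ) 400).filter (fun p => |(8 * |p| - |n|)| < 400) then 0
      else c ![q, n]) = OFF at hX ⊢
    generalize hR : (2 * π * (|(n : ℝ)| * ((2 * Real.exp (1 / 2) - 1) * P.δ₀ / π))) ^ 2 *
        ∑ p ∈ (Finset.Icc (-400 : ℤ) 400).filter (fun p => |(8 * |p| - |n|)| < 400), c ![p, n] = R at hX h2
    generalize hκ' : ((2 : ℝ)⁻¹ ^ 27 * 3600) ^ 2 = κ at h2 ⊢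
    generalize ht1 : 1 + 1 / t = t1 at hX h2 hts0 ⊢
    generalize hs1 : 1 + 1 / s = s1 at hX h2 hts0 ⊢
    have e : (1 + t + t1 * s1 * κ / γ₀) * A + t1 * (1 + s) * OFF - ((1 + t) * A + t1 * ((1 + s) * OFF + s1 * R)) =
        t1 * s1 * (κ / γ₀ * A) - t1 * s1 * R := by ring
    nlinarith [hX, h2, e]
  -- §D sum over the fibres and regroup onto the H-fibres
  have hD : ∑ n ∈ (Finset.Icc (-3600 : ℤ) 3600).filter (fun n => 120 ≤ |n|),
      ∑ m ∈ Finset.Icc (-(if |n| < 200 then (799 : ℤ) else 4 * |n|)) (if |n| < 200 then (799 : ℤ) else 4 * |n|), c₂ ![m, n] ≤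
      (1 + t + (1 + 1 / t) * (1 + 1 / s) * ((2 : ℝ)⁻¹ ^ 27 * 3600) ^ 2 / γ₀) * ∑ p ∈ Finset.Icc (-400 : ℤ) 400, V p +
        (1 + 1 / t) * (1 + s) * ∑ n ∈ (Finset.Icc (-3600 : ℤ) 3600).filter (fun n => 120 ≤ |n|),
          ∑' q : ℤ, (if q ∈ (Finset.Icc (-400 : ℤ) 400).filter (fun p => |(8 * |p| - |n|)| < 400) then 0 else c ![q, n]) := by
    refine (Finset.sum_le_sum hfib).trans ?_
    rw [Finset.sum_add_distrib, ← Finset.mul_sum, ← Finset.mul_sum]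
    have hswap : ∑ n ∈ (Finset.Icc (-3600 : ℤ) 3600).filter (fun n => 120 ≤ |n|),
        Γ n * ∑ p ∈ (Finset.Icc (-400 : ℤ) 400).filter (fun p => |(8 * |p| - |n|)| < 400), c ![p, n] / u n p ≤
        ∑ p ∈ Finset.Icc (-400 : ℤ) 400, V p := by
      have e : ∀ n : ℤ, Γ n * ∑ p ∈ (Finset.Icc (-400 : ℤ) 400).filter (fun p => |(8 * |p| - |n|)| < 400), c ![p, n] / u n p =
          ∑ p ∈ (Finset.Icc (-400 : ℤ) 400).filter (fun p => |(8 * |p| - |n|)| < 400), Γ n / u n p * c ![p, n] := fun n => by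
        rw [Finset.mul_sum]; exact Finset.sum_congr rfl fun p _ => by ring
      rw [Finset.sum_congr rfl fun n _ => e n, sum_tube_swap (fun n p => Γ n / u n p * c ![p, n])]
      exact Finset.sum_le_sum fun p hp => hV p hp
    have := mul_le_mul_of_nonneg_left hswap
      (by positivity : (0:ℝ) ≤ 1 + t + (1 + 1 / t) * (1 + 1 / s) * ((2 : ℝ)⁻¹ ^ 27 * 3600) ^ 2 / γ₀)
    linarith
  -- §E off-tube sources and the tail
  have hE := offTube_tail_le P hγ hN₀ hρN hd hδ₀ hδ₀' a b h0 hb hab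
  simp only [← hc, ← hc₂] at hE
  have hts : 1 ≤ (1 + 1 / t) * (1 + s) := by nlinarith [one_div_pos.2 ht]
  have hT0 : 0 ≤ ∑' k, χT k * c₂ k := tsum_nonneg fun k => mul_nonneg (hT01 k).1 (hc₂0 k)
  have hE' := mul_le_mul_of_nonneg_left hE (by positivity : (0:ℝ) ≤ (1 + 1 / t) * (1 + s))
  have hT1 : ∑' k, χT k * c₂ k ≤ (1 + 1 / t) * (1 + s) * ∑' k, χT k * c₂ k := by nlinarith
  simp only [hχV, hχOc, hχT, hc₂] at hA hBeq hD hE' hT1 hT0 ⊢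
  linarith [hA, hBeq, hD, hE', hT1]

end Cascade

end Summit.AnomalousDissipation.AnomalousDissipation.Theorems.SawtoothPulseCascade.K1Start
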